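/-
Copyright: b2b-lace packet (LEAN TYPING SEAT 1 gen 35, node KU-SEP-MUNIFORM-LITBOUND, a leaf under the
m-UNIFORM `J = 0` device of `SrwTwistTruncationSeeds` / `SrwTwistProductSliceBudget`). The LITERAL-READY
form of the device: the Bessel numbers `J_0(β/d)`, `δ_0(β/d)` and the plain seeds on the right-hand side are
replaced by SCALAR bounds `|q − J_0(β/d)| ≤ e`, `δ_0(β/d) ≤ δ̄`, `seed_k ≤ I_k` (or ONE axis seed), and the
main term `J_0(β/d)^d ·(mass)` by the literal `q^d ·(mass)` at the cost `d·e·(|q|+e)^{d−1}·(mass bound)`;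
rational-input shapes included. d-generic; number-free; def-free; what-if / input-certification lane SUPPORT;
nothing here is a certificate; no statement at any fixed dimension.
-/
import Literature.Probability.FitznerVanDerHofstad2017.SrwTwistTruncationSeeds
import Literature.Probability.FitznerVanDerHofstad2017.SrwTwistProductSliceBudget
import Literature.Probability.FitznerVanDerHofstad2017.SrwIntegralJFarField
import HarnessLib

/-!
# The m-uniform twisted-seed device with literal (scalar) inputs

CITATION HEADER (PLACEMENT v2). Part of the certified REPRODUCTION of the numerical inputs of
R. Fitzner, R. van der Hofstad, *Generalized approach to the non-backtracking lace expansion*,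
Probab. Theory Related Fields 169 (2017) 1041–1119 [NoBLE17-I] (arXiv:1506.07969): the SRW Fourier
integrals (3.34)–(3.38) p. 1071 evaluated through Bessel rows, §5.1.1 (5.2)–(5.5) pp. 1089–1090 (the
notebook `SRW.nb`); Bessel facts from NIST DLMF §10.2.2, §10.14.4, §10.35.2 [DLMF].  Nothing in this file
is a claim of the paper beyond those formulas; everything below is PROVED.

## What this module adds

The m-UNIFORM device (`J = 0`) of `SrwTwistTruncationSeeds` (`abs_srwTwist_sub_besselJ_zero_pow_mul_srwI_le`,
unit weight) and of `SrwTwistProductSliceBudget` (`abs_srwTwist_prodCosPow_sub_besselJ_zero_pow_mul_le`,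
cosine-power product weights) bounds, for EVERY `m` with `|m| ≥ M` at once,
`|Tw_{n+1}(m e_i; β) − J_0(β/d)^d · (β = 0 mass)|` by
`Σ_{k<d} C(d,k+1) |J_0(β/d)|^{d−(k+1)} (2δ_0(β/d))^{k+1} · srwI d (n+1) 0 (c(e_0+…+e_k))`
(`δ_0(y) = Σ_{l≥0}|J_{l+1}(y)|`; no `|J_0|` factor in the product form; `c = M` resp. `M − a_max`).
The right-hand side and the main term still contain the real numbers `J_0(β/d)`, `δ_0(β/d)` and `d` plain
seeds.  This module reduces them to SCALARS a consumer supplies as literals: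

* `abs_srwTwist_sub_besselJ_zero_pow_mul_srwI_le_of_lit` / `abs_srwTwist_prodCosPow_sub_besselJ_zero_pow_mul_le_of_lit`
  — from `|q − J_0(β/d)| ≤ e`, `δ_0(β/d) ≤ δ̄` and seed bounds `seed_k ≤ I_k` (`I : ℕ → ℝ`) the error is
  `≤ Σ_{k<d} C(d,k+1)(|q|+e)^{d−(k+1)}(2δ̄)^{k+1} I_k` resp. `≤ Σ_{k<d} C(d,k+1)(2δ̄)^{k+1} I_k`;
* `…_of_lit_main` — the main term made literal: `|Tw − q^d · (mass)| ≤ (error above) + d·e·(|q|+e)^{d−1}·T̄`,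
  `T̄` a bound of the mass (`srwI d (n+1) 0 0 ≤ T̄` resp. `|Tw^{Πcos^{a}}_{n+1}(0; 0)| ≤ T̄`; the product
  mass is written at the ORIGIN node by `srwTwist_zero_right_eq`, so nothing on either side depends on `m`
  except the slice itself), via `abs_pow_sub_pow_le`;
* `…_of_lit_main_cast` — the same with `q, e, δ̄, T̄ ∈ ℚ` and a rational seed table `I : ℕ → ℚ`, the whole
  right-hand side ONE rational expression cast to `ℝ`;
* `…_of_lit_axis` — ONE-AXIS-SEED coarsening (`srwI_twoLevel_le_axis`): all `d` two-level seeds replaced by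
  the axis seed `srwI d (n+1) 0 (c e_0) ≤ I₁`, error `((|q|+e+2δ̄)^d − (|q|+e)^d)·I₁` resp. `((1+2δ̄)^d − 1)·I₁`
  (binomial resummation) plus the main-term cost;
* `…_of_lit_axis_cast` — the same with `q, e, δ̄, I₁, T̄ ∈ ℚ` and the whole right-hand side ONE rational
  expression cast to `ℝ`, the shape a kernel-decided literal inequality consumes.

Tree sources of the scalars: `e`, `q` from a decided `JLit.Cert` (`BesselJLiteralCert`); `δ̄` from
`BesselJOrderTailGeometric` (`tsum_abs_besselJ_orderTail_le_sum_add_geom`, any `y² ≤ 4(J+2)` after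
splitting off finitely many orders) or `tsum_abs_besselJ_tail_le_of_abs_le_one`; `I_k`, `I₁`, `T̄` from
decided SEEDCERT class certificates / the origin I-table / a `β = 0` product-row certificate.  Everything is
PROVED (standard axioms), generic in the dimension `d`, number-free and def-free; no instance, no table, no
named fact.  Epistemic status / lane: what-if / input-certification SUPPORT; nothing here is a certificate;
no statement at a specific dimension.

## References
* R. Fitzner, R. van der Hofstad, *Generalized approach to the non-backtracking lace expansion*,
  PTRF 169 (2017) 1041–1119 (arXiv:1506.07969), (3.34)–(3.38) p. 1071, §5.1.1 (5.2)–(5.5) pp. 1089–1090.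
  [FitznerVanDerHofstad2016NoBLE]
* NIST DLMF §10.2.2, §10.14.4, §10.35.2. [DLMF]
[cite: FitznerVanDerHofstad2016NoBLE, (3.34)–(3.38) p. 1071, §5.1.1 (5.2)–(5.5) pp. 1089–1090; DLMF, 10.2.2, 10.14.4, 10.35.2]
-/

noncomputable section

open MeasureTheory Set Real
open scoped Nat

namespace Literature.Probability.FitznerVanDerHofstad2017

open Literature.Probability.LatticeModels (besselI)
open Literature.Analysis.FunctionSpaces (besselJ)

variable {d : ℕ}

/-! ### Scalar lemmas -/

/-- `Σ_{k<D} C(D,k+1) a^{D−(k+1)} b^{k+1} = (a+b)^D − a^D`. [folklore] -/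
private theorem sum_choose_succ_mul_pow_mul_pow_succ (D : ℕ) (a b : ℝ) :
    ∑ k ∈ Finset.range D, (D.choose (k + 1) : ℝ) * a ^ (D - (k + 1)) * b ^ (k + 1)
      = (a + b) ^ D - a ^ D := by
  have h := add_pow b a D
  rw [Finset.sum_range_succ'] at h
  simp only [pow_zero, one_mul, Nat.sub_zero, Nat.choose_zero_right, Nat.cast_one, mul_one] at h
  have h' : ∑ k ∈ Finset.range D, (D.choose (k + 1) : ℝ) * a ^ (D - (k + 1)) * b ^ (k + 1)
      = ∑ k ∈ Finset.range D, b ^ (k + 1) * a ^ (D - (k + 1)) * (D.choose (k + 1) : ℝ) :=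
    Finset.sum_congr rfl fun k _ => by ring
  rw [h', add_comm a b, h]
  ring

/-- `Σ_{k<D} C(D,k+1) b^{k+1} = (1+b)^D − 1`. [folklore] -/
private theorem sum_choose_succ_mul_pow_succ' (D : ℕ) (b : ℝ) :
    ∑ k ∈ Finset.range D, (D.choose (k + 1) : ℝ) * b ^ (k + 1) = (1 + b) ^ D - 1 := by
  have h := sum_choose_succ_mul_pow_mul_pow_succ D 1 b
  simp only [one_pow, mul_one] at h
  exact h

/-- `|x^D − q^D| ≤ D·e·(|q|+e)^{D−1}` when `|q − x| ≤ e` (`abs_pow_sub_pow_le`). [folklore] -/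
private theorem abs_pow_sub_pow_le_of_abs_sub_le {x q e : ℝ} (h : |q - x| ≤ e) (D : ℕ) :
    |x ^ D - q ^ D| ≤ D * e * (|q| + e) ^ (D - 1) := by
  have he0 : 0 ≤ e := (abs_nonneg _).trans h
  have hx : |x| ≤ |q| + e := by
    have := abs_sub_abs_le_abs_sub x q
    rw [abs_sub_comm] at h
    linarith
  have hmax : max |x| |q| ≤ |q| + e := max_le hx (by linarith)
  calc |x ^ D - q ^ D| ≤ |x - q| * D * max |x| |q| ^ (D - 1) := abs_pow_sub_pow_le x q D
    _ ≤ e * D * (|q| + e) ^ (D - 1) := by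
        have h1 : |x - q| ≤ e := by rwa [abs_sub_comm] at h
        have h2 : max |x| |q| ^ (D - 1) ≤ (|q| + e) ^ (D - 1) :=
          pow_le_pow_left₀ (le_max_of_le_left (abs_nonneg _)) hmax _
        exact mul_le_mul (mul_le_mul_of_nonneg_right h1 (Nat.cast_nonneg _)) h2
          (pow_nonneg ((abs_nonneg _).trans (le_max_left _ _)) _) (by positivity)
    _ = D * e * (|q| + e) ^ (D - 1) := by ring

/-! ### Unit weight: `Tw_{n+1}(m e_i; β)` against `J_0(β/d)^d · I_{n+1,0}(0)` -/

/-- **m-uniform device, unit weight, scalar inputs.** For `2(n+1)+1 ≤ d`, `m ≠ 0`, `|m| ≥ M`: if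
`|q − J_0(β/d)| ≤ e`, `δ_0(β/d) = Σ_{l≥0}|J_{l+1}(β/d)| ≤ δ̄` and `srwI d (n+1) 0 (M(e_0+…+e_k)) ≤ I_k` for
`k < d`, then
`|Tw_{n+1}(m e_i; β) − J_0(β/d)^d · srwI d (n+1) 0 0| ≤ Σ_{k<d} C(d,k+1)(|q|+e)^{d−(k+1)}(2δ̄)^{k+1} I_k`.
[cite: FitznerVanDerHofstad2016NoBLE, (3.34)–(3.36) p. 1071, §5.1.1 (5.2)–(5.5) pp. 1089–1090; DLMF, 10.2.2, 10.14.4, 10.35.2] -/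
theorem abs_srwTwist_sub_besselJ_zero_pow_mul_srwI_le_of_lit (n : ℕ) (hd : 2 * (n + 1) + 1 ≤ d)
    (i : Fin d) {m : ℤ} (hm : m ≠ 0) (β : ℝ) (M : ℕ) (hM : M ≤ m.natAbs)
    {q e δb : ℝ} {I : ℕ → ℝ}
    (hq : |q - besselJ 0 (β / d)| ≤ e)
    (hδ : ∑' l : ℕ, |besselJ (l + 1) (β / d)| ≤ δb)
    (hIk : ∀ k ∈ Finset.range d,
      srwI d (n + 1) 0 (fun μ : Fin d => if (μ : ℕ) < k + 1 then (M : ℤ) else 0) ≤ I k) :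
    |srwTwist d (n + 1) (fun _ => 1) (Pi.single i m) β
      - besselJ 0 (β / d) ^ d * srwI d (n + 1) 0 (fun _ => 0)|
    ≤ ∑ k ∈ Finset.range d, (d.choose (k + 1) : ℝ) * (|q| + e) ^ (d - (k + 1))
        * (2 * δb) ^ (k + 1) * I k := by
  have he0 : 0 ≤ e := (abs_nonneg _).trans hq
  have hJ : |besselJ 0 (β / d)| ≤ |q| + e := by
    have := abs_sub_abs_le_abs_sub (besselJ 0 (β / d)) q
    rw [abs_sub_comm] at hq
    linarith
  have hδ0 : 0 ≤ ∑' l : ℕ, |besselJ (l + 1) (β / d)| := tsum_nonneg fun _ => abs_nonneg _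
  refine (abs_srwTwist_sub_besselJ_zero_pow_mul_srwI_le n hd i hm β M hM).trans
    (Finset.sum_le_sum fun k hk => ?_)
  have hS0 : 0 ≤ srwI d (n + 1) 0 (fun μ : Fin d => if (μ : ℕ) < k + 1 then (M : ℤ) else 0) :=
    srwI_nonneg (d := d) (n + 1) hd 0 _
  have h1 : |besselJ 0 (β / d)| ^ (d - (k + 1)) ≤ (|q| + e) ^ (d - (k + 1)) :=
    pow_le_pow_left₀ (abs_nonneg _) hJ _
  have h2 : (2 * ∑' l : ℕ, |besselJ (l + 1) (β / d)|) ^ (k + 1) ≤ (2 * δb) ^ (k + 1) :=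
    pow_le_pow_left₀ (by positivity) (by linarith) _
  have h12 : (d.choose (k + 1) : ℝ) * |besselJ 0 (β / d)| ^ (d - (k + 1))
        * (2 * ∑' l : ℕ, |besselJ (l + 1) (β / d)|) ^ (k + 1)
      ≤ (d.choose (k + 1) : ℝ) * (|q| + e) ^ (d - (k + 1)) * (2 * δb) ^ (k + 1) :=
    mul_le_mul (mul_le_mul_of_nonneg_left h1 (Nat.cast_nonneg _)) h2 (by positivity) (by positivity)
  exact mul_le_mul h12 (hIk k hk) hS0 ((by positivity : (0:ℝ) ≤ _).trans h12)

/-- **m-uniform device, unit weight, literal main term.** Under the hypotheses of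
`abs_srwTwist_sub_besselJ_zero_pow_mul_srwI_le_of_lit` and `srwI d (n+1) 0 0 ≤ T̄`:
`|Tw_{n+1}(m e_i; β) − q^d · srwI d (n+1) 0 0| ≤ Σ_{k<d} C(d,k+1)(|q|+e)^{d−(k+1)}(2δ̄)^{k+1} I_k + d·e·(|q|+e)^{d−1}·T̄`
(`|J_0^d − q^d| ≤ d·e·(|q|+e)^{d−1}`, `abs_pow_sub_pow_le`).
[cite: FitznerVanDerHofstad2016NoBLE, (3.34)–(3.36) p. 1071, §5.1.1 (5.2)–(5.5) pp. 1089–1090; DLMF, 10.2.2, 10.14.4, 10.35.2] -/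
theorem abs_srwTwist_sub_lit_pow_mul_srwI_le_of_lit_main (n : ℕ) (hd : 2 * (n + 1) + 1 ≤ d)
    (i : Fin d) {m : ℤ} (hm : m ≠ 0) (β : ℝ) (M : ℕ) (hM : M ≤ m.natAbs)
    {q e δb T : ℝ} {I : ℕ → ℝ}
    (hq : |q - besselJ 0 (β / d)| ≤ e)
    (hδ : ∑' l : ℕ, |besselJ (l + 1) (β / d)| ≤ δb)
    (hIk : ∀ k ∈ Finset.range d,
      srwI d (n + 1) 0 (fun μ : Fin d => if (μ : ℕ) < k + 1 then (M : ℤ) else 0) ≤ I k)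
    (hT : srwI d (n + 1) 0 (fun _ => 0) ≤ T) :
    |srwTwist d (n + 1) (fun _ => 1) (Pi.single i m) β - q ^ d * srwI d (n + 1) 0 (fun _ => 0)|
    ≤ (∑ k ∈ Finset.range d, (d.choose (k + 1) : ℝ) * (|q| + e) ^ (d - (k + 1))
        * (2 * δb) ^ (k + 1) * I k) + d * e * (|q| + e) ^ (d - 1) * T := by
  have he0 : 0 ≤ e := (abs_nonneg _).trans hq
  have hI0 : 0 ≤ srwI d (n + 1) 0 (fun _ : Fin d => 0) := srwI_nonneg (d := d) (n + 1) hd 0 _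
  have h1 := abs_srwTwist_sub_besselJ_zero_pow_mul_srwI_le_of_lit n hd i hm β M hM hq hδ hIk
  have hpow : |besselJ 0 (β / d) ^ d - q ^ d| ≤ d * e * (|q| + e) ^ (d - 1) :=
    abs_pow_sub_pow_le_of_abs_sub_le hq d
  have h2 : |besselJ 0 (β / d) ^ d * srwI d (n + 1) 0 (fun _ => 0) - q ^ d * srwI d (n + 1) 0 (fun _ => 0)|
      ≤ d * e * (|q| + e) ^ (d - 1) * T := by
    rw [← sub_mul, abs_mul, abs_of_nonneg hI0]
    exact mul_le_mul hpow hT hI0 (by positivity)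
  calc |srwTwist d (n + 1) (fun _ => 1) (Pi.single i m) β - q ^ d * srwI d (n + 1) 0 (fun _ => 0)|
      = |(srwTwist d (n + 1) (fun _ => 1) (Pi.single i m) β
            - besselJ 0 (β / d) ^ d * srwI d (n + 1) 0 (fun _ => 0))
          + (besselJ 0 (β / d) ^ d * srwI d (n + 1) 0 (fun _ => 0)
            - q ^ d * srwI d (n + 1) 0 (fun _ => 0))| := by ring_nf
    _ ≤ _ := (abs_add_le _ _).trans (add_le_add h1 h2)

/-- **m-uniform device, unit weight, rational inputs (seed vector).** With `q, e, δ̄, T̄ ∈ ℚ` and a rational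
seed table `I : ℕ → ℚ` (`srwI d (n+1) 0 (M(e_0+…+e_k)) ≤ I_k`, `k < d`):
`|Tw_{n+1}(m e_i; β) − q^d · srwI d (n+1) 0 0| ≤ ((Σ_{k<d} C(d,k+1)(|q|+e)^{d−(k+1)}(2δ̄)^{k+1} I_k + d·e·(|q|+e)^{d−1}·T̄ : ℚ) : ℝ)`
for every `|m| ≥ M`, `m ≠ 0`.
[cite: FitznerVanDerHofstad2016NoBLE, (3.34)–(3.36) p. 1071, §5.1.1 (5.2)–(5.5) pp. 1089–1090; DLMF, 10.2.2, 10.14.4, 10.35.2] -/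
theorem abs_srwTwist_sub_lit_pow_mul_srwI_le_of_lit_main_cast (n : ℕ) (hd : 2 * (n + 1) + 1 ≤ d)
    (i : Fin d) {m : ℤ} (hm : m ≠ 0) (β : ℝ) (M : ℕ) (hM : M ≤ m.natAbs)
    {q e δb T : ℚ} {I : ℕ → ℚ}
    (hq : |(q : ℝ) - besselJ 0 (β / d)| ≤ (e : ℝ))
    (hδ : ∑' l : ℕ, |besselJ (l + 1) (β / d)| ≤ (δb : ℝ))
    (hIk : ∀ k ∈ Finset.range d,
      srwI d (n + 1) 0 (fun μ : Fin d => if (μ : ℕ) < k + 1 then (M : ℤ) else 0) ≤ ((I k : ℚ) : ℝ))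
    (hT : srwI d (n + 1) 0 (fun _ => 0) ≤ (T : ℝ)) :
    |srwTwist d (n + 1) (fun _ => 1) (Pi.single i m) β - (q : ℝ) ^ d * srwI d (n + 1) 0 (fun _ => 0)|
    ≤ ((((∑ k ∈ Finset.range d, (d.choose (k + 1) : ℚ) * (|q| + e) ^ (d - (k + 1))
          * (2 * δb) ^ (k + 1) * I k) + d * e * (|q| + e) ^ (d - 1) * T) : ℚ) : ℝ) := by
  have h := abs_srwTwist_sub_lit_pow_mul_srwI_le_of_lit_main n hd i hm β M hM (I := fun k => ((I k : ℚ) : ℝ))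
    hq hδ hIk hT
  push_cast
  exact h

/-- **m-uniform device, unit weight, ONE axis seed.** For `2(n+1)+1 ≤ d`, `m ≠ 0`, `|m| ≥ M`: if
`|q − J_0(β/d)| ≤ e`, `δ_0(β/d) ≤ δ̄`, `srwI d (n+1) 0 (M e_0) ≤ I₁` and `srwI d (n+1) 0 0 ≤ T̄`, then
`|Tw_{n+1}(m e_i; β) − q^d · srwI d (n+1) 0 0| ≤ ((|q|+e+2δ̄)^d − (|q|+e)^d)·I₁ + d·e·(|q|+e)^{d−1}·T̄`
(all two-level seeds majorised by the axis seed, `srwI_twoLevel_le_axis`; binomial resummation).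
[cite: FitznerVanDerHofstad2016NoBLE, (3.34)–(3.36) p. 1071, §5.1.1 (5.2)–(5.5) pp. 1089–1090; DLMF, 10.2.2, 10.14.4, 10.35.2] -/
theorem abs_srwTwist_sub_lit_pow_mul_srwI_le_of_lit_axis (n : ℕ) (hd : 2 * (n + 1) + 1 ≤ d)
    (i : Fin d) {m : ℤ} (hm : m ≠ 0) (β : ℝ) (M : ℕ) (hM : M ≤ m.natAbs)
    {q e δb I₁ T : ℝ}
    (hq : |q - besselJ 0 (β / d)| ≤ e)
    (hδ : ∑' l : ℕ, |besselJ (l + 1) (β / d)| ≤ δb)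
    (hI₁ : srwI d (n + 1) 0 (fun μ : Fin d => if (μ : ℕ) < 1 then (M : ℤ) else 0) ≤ I₁)
    (hT : srwI d (n + 1) 0 (fun _ => 0) ≤ T) :
    |srwTwist d (n + 1) (fun _ => 1) (Pi.single i m) β - q ^ d * srwI d (n + 1) 0 (fun _ => 0)|
    ≤ ((|q| + e + 2 * δb) ^ d - (|q| + e) ^ d) * I₁ + d * e * (|q| + e) ^ (d - 1) * T := by
  have hd3 : 2 * n + 3 ≤ d := by omega
  have hIk : ∀ k ∈ Finset.range d,
      srwI d (n + 1) 0 (fun μ : Fin d => if (μ : ℕ) < k + 1 then (M : ℤ) else 0) ≤ I₁ :=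
    fun k _ => (srwI_twoLevel_le_axis n hd3 (by omega : 1 ≤ k + 1) (M : ℤ)).trans hI₁
  have h := abs_srwTwist_sub_lit_pow_mul_srwI_le_of_lit_main n hd i hm β M hM (I := fun _ => I₁)
    hq hδ hIk hT
  have hsum : ∑ k ∈ Finset.range d, (d.choose (k + 1) : ℝ) * (|q| + e) ^ (d - (k + 1))
        * (2 * δb) ^ (k + 1) * I₁ = ((|q| + e + 2 * δb) ^ d - (|q| + e) ^ d) * I₁ := by
    rw [← Finset.sum_mul, sum_choose_succ_mul_pow_mul_pow_succ]
  rw [hsum] at h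
  exact h

/-- **m-uniform device, unit weight, rational inputs (one axis seed).** With `q, e, δ̄, I₁, T̄ ∈ ℚ`:
`|Tw_{n+1}(m e_i; β) − q^d · srwI d (n+1) 0 0| ≤ ((((|q|+e+2δ̄)^d − (|q|+e)^d)·I₁ + d·e·(|q|+e)^{d−1}·T̄ : ℚ) : ℝ)`
for every `|m| ≥ M`, `m ≠ 0` — one rational expression in the literals.
[cite: FitznerVanDerHofstad2016NoBLE, (3.34)–(3.36) p. 1071, §5.1.1 (5.2)–(5.5) pp. 1089–1090; DLMF, 10.2.2, 10.14.4, 10.35.2] -/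
theorem abs_srwTwist_sub_lit_pow_mul_srwI_le_of_lit_axis_cast (n : ℕ) (hd : 2 * (n + 1) + 1 ≤ d)
    (i : Fin d) {m : ℤ} (hm : m ≠ 0) (β : ℝ) (M : ℕ) (hM : M ≤ m.natAbs)
    {q e δb I₁ T : ℚ}
    (hq : |(q : ℝ) - besselJ 0 (β / d)| ≤ (e : ℝ))
    (hδ : ∑' l : ℕ, |besselJ (l + 1) (β / d)| ≤ (δb : ℝ))
    (hI₁ : srwI d (n + 1) 0 (fun μ : Fin d => if (μ : ℕ) < 1 then (M : ℤ) else 0) ≤ (I₁ : ℝ))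
    (hT : srwI d (n + 1) 0 (fun _ => 0) ≤ (T : ℝ)) :
    |srwTwist d (n + 1) (fun _ => 1) (Pi.single i m) β - (q : ℝ) ^ d * srwI d (n + 1) 0 (fun _ => 0)|
    ≤ (((((|q| + e + 2 * δb) ^ d - (|q| + e) ^ d) * I₁ + d * e * (|q| + e) ^ (d - 1) * T) : ℚ) : ℝ) := by
  have h := abs_srwTwist_sub_lit_pow_mul_srwI_le_of_lit_axis n hd i hm β M hM hq hδ hI₁ hT
  push_cast
  exact h

/-! ### Cosine-power product weights: `Tw^{Π cos^{a}}_{n+1}(m e_i; β)` against `J_0(β/d)^d ·(β = 0 mass)` -/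

/-- **m-uniform device, product weight, scalar inputs.** For `2(n+1)+1 ≤ d`, `m ≠ 0`, `|m| ≥ M`,
`a_μ ≤ a_max ≤ M`: if `δ_0(β/d) ≤ δ̄` and `srwI d (n+1) 0 ((M − a_max)(e_0+…+e_k)) ≤ I_k` for `k < d`, then
`|Tw^{Πcos^{a}}_{n+1}(m e_i; β) − J_0(β/d)^d · Tw^{Πcos^{a}}_{n+1}(m e_i; 0)| ≤ Σ_{k<d} C(d,k+1)(2δ̄)^{k+1} I_k`.
[cite: FitznerVanDerHofstad2016NoBLE, (3.34)–(3.38) p. 1071, §5.1.1 (5.2)–(5.5) pp. 1089–1090; DLMF, 10.2.2, 10.14.4, 10.35.2] -/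
theorem abs_srwTwist_prodCosPow_sub_besselJ_zero_pow_mul_le_of_lit (n : ℕ) (hd : 2 * (n + 1) + 1 ≤ d)
    (i : Fin d) {m : ℤ} (hm : m ≠ 0) (β : ℝ) (a : Fin d → ℕ) (M amax : ℕ) (hM : M ≤ m.natAbs)
    (ha : ∀ μ, a μ ≤ amax) (hamax : amax ≤ M)
    {δb : ℝ} {I : ℕ → ℝ}
    (hδ : ∑' l : ℕ, |besselJ (l + 1) (β / d)| ≤ δb)
    (hIk : ∀ k ∈ Finset.range d,
      srwI d (n + 1) 0 (fun μ : Fin d => if (μ : ℕ) < k + 1 then (((M - amax : ℕ)) : ℤ) else 0) ≤ I k) :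
    |srwTwist d (n + 1) (fun k => ∏ μ, Real.cos (k μ) ^ a μ) (Pi.single i m) β
      - besselJ 0 (β / d) ^ d
        * srwTwist d (n + 1) (fun k => ∏ μ, Real.cos (k μ) ^ a μ) (Pi.single i m) 0|
    ≤ ∑ k ∈ Finset.range d, (d.choose (k + 1) : ℝ) * (2 * δb) ^ (k + 1) * I k := by
  have hδ0 : 0 ≤ ∑' l : ℕ, |besselJ (l + 1) (β / d)| := tsum_nonneg fun _ => abs_nonneg _
  refine (abs_srwTwist_prodCosPow_sub_besselJ_zero_pow_mul_le n hd i hm β a M amax hM ha hamax).trans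
    (Finset.sum_le_sum fun k hk => ?_)
  have hS0 : 0 ≤ srwI d (n + 1) 0
      (fun μ : Fin d => if (μ : ℕ) < k + 1 then (((M - amax : ℕ)) : ℤ) else 0) :=
    srwI_nonneg (d := d) (n + 1) hd 0 _
  have h2 : (2 * ∑' l : ℕ, |besselJ (l + 1) (β / d)|) ^ (k + 1) ≤ (2 * δb) ^ (k + 1) :=
    pow_le_pow_left₀ (by positivity) (by linarith) _
  have h12 : (d.choose (k + 1) : ℝ) * (2 * ∑' l : ℕ, |besselJ (l + 1) (β / d)|) ^ (k + 1)
      ≤ (d.choose (k + 1) : ℝ) * (2 * δb) ^ (k + 1) := mul_le_mul_of_nonneg_left h2 (Nat.cast_nonneg _)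
  exact mul_le_mul h12 (hIk k hk) hS0 ((by positivity : (0:ℝ) ≤ _).trans h12)

/-- **m-uniform device, product weight, literal main term at the origin node.** Under the hypotheses of
`abs_srwTwist_prodCosPow_sub_besselJ_zero_pow_mul_le_of_lit`, `|q − J_0(β/d)| ≤ e` and
`|Tw^{Πcos^{a}}_{n+1}(0; 0)| ≤ T̄` (the `β = 0` MASS of the weight, node-independent by `srwTwist_zero_right_eq`):
`|Tw^{Πcos^{a}}_{n+1}(m e_i; β) − q^d · Tw^{Πcos^{a}}_{n+1}(0; 0)| ≤ Σ_{k<d} C(d,k+1)(2δ̄)^{k+1} I_k + d·e·(|q|+e)^{d−1}·T̄`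
— nothing on the right, and nothing in the main term, depends on `m`.
[cite: FitznerVanDerHofstad2016NoBLE, (3.34)–(3.38) p. 1071, §5.1.1 (5.2)–(5.5) pp. 1089–1090; DLMF, 10.2.2, 10.14.4, 10.35.2] -/
theorem abs_srwTwist_prodCosPow_sub_lit_pow_mul_le_of_lit_main (n : ℕ) (hd : 2 * (n + 1) + 1 ≤ d)
    (i : Fin d) {m : ℤ} (hm : m ≠ 0) (β : ℝ) (a : Fin d → ℕ) (M amax : ℕ) (hM : M ≤ m.natAbs)
    (ha : ∀ μ, a μ ≤ amax) (hamax : amax ≤ M)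
    {q e δb T : ℝ} {I : ℕ → ℝ}
    (hq : |q - besselJ 0 (β / d)| ≤ e)
    (hδ : ∑' l : ℕ, |besselJ (l + 1) (β / d)| ≤ δb)
    (hIk : ∀ k ∈ Finset.range d,
      srwI d (n + 1) 0 (fun μ : Fin d => if (μ : ℕ) < k + 1 then (((M - amax : ℕ)) : ℤ) else 0) ≤ I k)
    (hT : |srwTwist d (n + 1) (fun k => ∏ μ, Real.cos (k μ) ^ a μ) (fun _ => 0) 0| ≤ T) :
    |srwTwist d (n + 1) (fun k => ∏ μ, Real.cos (k μ) ^ a μ) (Pi.single i m) β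
      - q ^ d * srwTwist d (n + 1) (fun k => ∏ μ, Real.cos (k μ) ^ a μ) (fun _ => 0) 0|
    ≤ (∑ k ∈ Finset.range d, (d.choose (k + 1) : ℝ) * (2 * δb) ^ (k + 1) * I k)
        + d * e * (|q| + e) ^ (d - 1) * T := by
  have he0 : 0 ≤ e := (abs_nonneg _).trans hq
  set T0 : ℝ := srwTwist d (n + 1) (fun k => ∏ μ, Real.cos (k μ) ^ a μ) (fun _ => 0) 0 with hT0
  have hnode : srwTwist d (n + 1) (fun k => ∏ μ, Real.cos (k μ) ^ a μ) (Pi.single i m) 0 = T0 :=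
    srwTwist_zero_right_eq (n + 1) _ _ _
  have h1 := abs_srwTwist_prodCosPow_sub_besselJ_zero_pow_mul_le_of_lit n hd i hm β a M amax hM ha
    hamax hδ hIk
  rw [hnode] at h1
  have hpow : |besselJ 0 (β / d) ^ d - q ^ d| ≤ d * e * (|q| + e) ^ (d - 1) :=
    abs_pow_sub_pow_le_of_abs_sub_le hq d
  have h2 : |besselJ 0 (β / d) ^ d * T0 - q ^ d * T0| ≤ d * e * (|q| + e) ^ (d - 1) * T := by
    rw [← sub_mul, abs_mul]
    exact mul_le_mul hpow hT (abs_nonneg _) (by positivity)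
  calc |srwTwist d (n + 1) (fun k => ∏ μ, Real.cos (k μ) ^ a μ) (Pi.single i m) β - q ^ d * T0|
      = |(srwTwist d (n + 1) (fun k => ∏ μ, Real.cos (k μ) ^ a μ) (Pi.single i m) β
            - besselJ 0 (β / d) ^ d * T0) + (besselJ 0 (β / d) ^ d * T0 - q ^ d * T0)| := by ring_nf
    _ ≤ _ := (abs_add_le _ _).trans (add_le_add h1 h2)

/-- **m-uniform device, product weight, rational inputs (seed vector).** With `q, e, δ̄, T̄ ∈ ℚ` and a
rational seed table `I : ℕ → ℚ` (`srwI d (n+1) 0 ((M − a_max)(e_0+…+e_k)) ≤ I_k`, `k < d`):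
`|Tw^{Πcos^{a}}_{n+1}(m e_i; β) − q^d · Tw^{Πcos^{a}}_{n+1}(0; 0)| ≤ ((Σ_{k<d} C(d,k+1)(2δ̄)^{k+1} I_k + d·e·(|q|+e)^{d−1}·T̄ : ℚ) : ℝ)`
for every `|m| ≥ M`, `m ≠ 0`.
[cite: FitznerVanDerHofstad2016NoBLE, (3.34)–(3.38) p. 1071, §5.1.1 (5.2)–(5.5) pp. 1089–1090; DLMF, 10.2.2, 10.14.4, 10.35.2] -/
theorem abs_srwTwist_prodCosPow_sub_lit_pow_mul_le_of_lit_main_cast (n : ℕ) (hd : 2 * (n + 1) + 1 ≤ d)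
    (i : Fin d) {m : ℤ} (hm : m ≠ 0) (β : ℝ) (a : Fin d → ℕ) (M amax : ℕ) (hM : M ≤ m.natAbs)
    (ha : ∀ μ, a μ ≤ amax) (hamax : amax ≤ M)
    {q e δb T : ℚ} {I : ℕ → ℚ}
    (hq : |(q : ℝ) - besselJ 0 (β / d)| ≤ (e : ℝ))
    (hδ : ∑' l : ℕ, |besselJ (l + 1) (β / d)| ≤ (δb : ℝ))
    (hIk : ∀ k ∈ Finset.range d,
      srwI d (n + 1) 0 (fun μ : Fin d => if (μ : ℕ) < k + 1 then (((M - amax : ℕ)) : ℤ) else 0)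
        ≤ ((I k : ℚ) : ℝ))
    (hT : |srwTwist d (n + 1) (fun k => ∏ μ, Real.cos (k μ) ^ a μ) (fun _ => 0) 0| ≤ (T : ℝ)) :
    |srwTwist d (n + 1) (fun k => ∏ μ, Real.cos (k μ) ^ a μ) (Pi.single i m) β
      - (q : ℝ) ^ d * srwTwist d (n + 1) (fun k => ∏ μ, Real.cos (k μ) ^ a μ) (fun _ => 0) 0|
    ≤ ((((∑ k ∈ Finset.range d, (d.choose (k + 1) : ℚ) * (2 * δb) ^ (k + 1) * I k)
          + d * e * (|q| + e) ^ (d - 1) * T) : ℚ) : ℝ) := by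
  have h := abs_srwTwist_prodCosPow_sub_lit_pow_mul_le_of_lit_main n hd i hm β a M amax hM ha hamax
    (I := fun k => ((I k : ℚ) : ℝ)) hq hδ hIk hT
  push_cast
  exact h

/-- **m-uniform device, product weight, ONE axis seed.** For `2(n+1)+1 ≤ d`, `m ≠ 0`, `|m| ≥ M`,
`a_μ ≤ a_max ≤ M`: if `|q − J_0(β/d)| ≤ e`, `δ_0(β/d) ≤ δ̄`, `srwI d (n+1) 0 ((M − a_max) e_0) ≤ I₁` and
`|Tw^{Πcos^{a}}_{n+1}(0; 0)| ≤ T̄`, then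
`|Tw^{Πcos^{a}}_{n+1}(m e_i; β) − q^d · Tw^{Πcos^{a}}_{n+1}(0; 0)| ≤ ((1+2δ̄)^d − 1)·I₁ + d·e·(|q|+e)^{d−1}·T̄`.
[cite: FitznerVanDerHofstad2016NoBLE, (3.34)–(3.38) p. 1071, §5.1.1 (5.2)–(5.5) pp. 1089–1090; DLMF, 10.2.2, 10.14.4, 10.35.2] -/
theorem abs_srwTwist_prodCosPow_sub_lit_pow_mul_le_of_lit_axis (n : ℕ) (hd : 2 * (n + 1) + 1 ≤ d)
    (i : Fin d) {m : ℤ} (hm : m ≠ 0) (β : ℝ) (a : Fin d → ℕ) (M amax : ℕ) (hM : M ≤ m.natAbs)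
    (ha : ∀ μ, a μ ≤ amax) (hamax : amax ≤ M)
    {q e δb I₁ T : ℝ}
    (hq : |q - besselJ 0 (β / d)| ≤ e)
    (hδ : ∑' l : ℕ, |besselJ (l + 1) (β / d)| ≤ δb)
    (hI₁ : srwI d (n + 1) 0 (fun μ : Fin d => if (μ : ℕ) < 1 then (((M - amax : ℕ)) : ℤ) else 0) ≤ I₁)
    (hT : |srwTwist d (n + 1) (fun k => ∏ μ, Real.cos (k μ) ^ a μ) (fun _ => 0) 0| ≤ T) :
    |srwTwist d (n + 1) (fun k => ∏ μ, Real.cos (k μ) ^ a μ) (Pi.single i m) β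
      - q ^ d * srwTwist d (n + 1) (fun k => ∏ μ, Real.cos (k μ) ^ a μ) (fun _ => 0) 0|
    ≤ ((1 + 2 * δb) ^ d - 1) * I₁ + d * e * (|q| + e) ^ (d - 1) * T := by
  have hd3 : 2 * n + 3 ≤ d := by omega
  have hIk : ∀ k ∈ Finset.range d,
      srwI d (n + 1) 0 (fun μ : Fin d => if (μ : ℕ) < k + 1 then (((M - amax : ℕ)) : ℤ) else 0) ≤ I₁ :=
    fun k _ => (srwI_twoLevel_le_axis n hd3 (by omega : 1 ≤ k + 1) (((M - amax : ℕ)) : ℤ)).trans hI₁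
  have h := abs_srwTwist_prodCosPow_sub_lit_pow_mul_le_of_lit_main n hd i hm β a M amax hM ha hamax
    (I := fun _ => I₁) hq hδ hIk hT
  have hsum : ∑ k ∈ Finset.range d, (d.choose (k + 1) : ℝ) * (2 * δb) ^ (k + 1) * I₁
      = ((1 + 2 * δb) ^ d - 1) * I₁ := by
    rw [← Finset.sum_mul, sum_choose_succ_mul_pow_succ']
  rw [hsum] at h
  exact h

/-- **m-uniform device, product weight, rational inputs (one axis seed).** With `q, e, δ̄, I₁, T̄ ∈ ℚ`:
`|Tw^{Πcos^{a}}_{n+1}(m e_i; β) − q^d · Tw^{Πcos^{a}}_{n+1}(0; 0)| ≤ ((((1+2δ̄)^d − 1)·I₁ + d·e·(|q|+e)^{d−1}·T̄ : ℚ) : ℝ)`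
for every `|m| ≥ M`, `m ≠ 0` — one rational expression in the literals.
[cite: FitznerVanDerHofstad2016NoBLE, (3.34)–(3.38) p. 1071, §5.1.1 (5.2)–(5.5) pp. 1089–1090; DLMF, 10.2.2, 10.14.4, 10.35.2] -/
theorem abs_srwTwist_prodCosPow_sub_lit_pow_mul_le_of_lit_axis_cast (n : ℕ) (hd : 2 * (n + 1) + 1 ≤ d)
    (i : Fin d) {m : ℤ} (hm : m ≠ 0) (β : ℝ) (a : Fin d → ℕ) (M amax : ℕ) (hM : M ≤ m.natAbs)
    (ha : ∀ μ, a μ ≤ amax) (hamax : amax ≤ M)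
    {q e δb I₁ T : ℚ}
    (hq : |(q : ℝ) - besselJ 0 (β / d)| ≤ (e : ℝ))
    (hδ : ∑' l : ℕ, |besselJ (l + 1) (β / d)| ≤ (δb : ℝ))
    (hI₁ : srwI d (n + 1) 0 (fun μ : Fin d => if (μ : ℕ) < 1 then (((M - amax : ℕ)) : ℤ) else 0) ≤ (I₁ : ℝ))
    (hT : |srwTwist d (n + 1) (fun k => ∏ μ, Real.cos (k μ) ^ a μ) (fun _ => 0) 0| ≤ (T : ℝ)) :
    |srwTwist d (n + 1) (fun k => ∏ μ, Real.cos (k μ) ^ a μ) (Pi.single i m) β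
      - (q : ℝ) ^ d * srwTwist d (n + 1) (fun k => ∏ μ, Real.cos (k μ) ^ a μ) (fun _ => 0) 0|
    ≤ (((((1 + 2 * δb) ^ d - 1) * I₁ + d * e * (|q| + e) ^ (d - 1) * T) : ℚ) : ℝ) := by
  have h := abs_srwTwist_prodCosPow_sub_lit_pow_mul_le_of_lit_axis n hd i hm β a M amax hM ha hamax
    hq hδ hI₁ hT
  push_cast
  exact h

end Literature.Probability.FitznerVanDerHofstad2017

end
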